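import Summits.Ventures.PackingBounds.Configurations.IntegerCodes
import Summits.Ventures.PackingBounds.Configurations.SubspaceTransfer

/-!
# Integer-point codes written in a bigger space: orthogonal integer normals + transfer to `ℝⁿ`

Framing: lottery ticket; floor = certified bounds/negative ranges. Venture `PackingBounds` (cell
`pub-packcert`, seat `pub-packcert-recog`, T5-ATTAINED) — attained-side infrastructure.

`IntegerCodes.lean` checks a list `L` of integer points `(x, w)`, `x ∈ ℤᵐ`, `x·x = w²`, with pairwise
cosines `≤ num/den`, and produces the code `IntCode.code m L ⊆ ℝᵐ`.  A code whose Gram matrix is rational but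
whose `ℚ`-span is not isometric to standard `ℚⁿ` has no such description in `ℝⁿ` itself, but always one in a
bigger `ℝᵐ` (Lagrange: every positive rational is a sum of four squares), inside an `n`-dimensional subspace.
This file adds the Boolean program `normalsOK L U m` (the integer vectors of `U` have length `m`, are nonzero,
pairwise orthogonal, and orthogonal to every `x` of `L`) and combines it with `Config.exists_transfer_orthogonal`
(`SubspaceTransfer.lean`): with `m = n + |U|` the code has an isometric copy in `ℝⁿ` —
`exists_code_transfer : ∃ C ⊆ ℝⁿ, |C| = |L|, unit norms, pairwise inner products ≤ num/den`.
-/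

namespace Summit.Ventures.PackingBounds.Config.IntCode

open Finset WithLp Summit.Ventures.PackingBounds.Config

/-- Normals check: every `u ∈ U` has length `m` and `u·u > 0`; distinct positions of `U` are orthogonal; every
`u ∈ U` is orthogonal to every point `x` of `L`. -/
def normalsOK (L : List (List ℤ × ℤ)) (U : List (List ℤ)) (m : ℕ) : Bool :=
  (U.all fun u => u.length == m && decide (0 < dotL u u)) &&
  ((List.range U.length).all fun i => (List.range U.length).all fun j =>
    i == j || dotL (U.getD i []) (U.getD j []) == 0) &&
  (U.all fun u => L.all fun p => dotL u p.1 == 0)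

/-- The vector of `ℝᵐ` attached to an integer list. -/
noncomputable def nvec (m : ℕ) (u : List ℤ) : EuclideanSpace ℝ (Fin m) :=
  toLp 2 fun i => ((u.getD i 0 : ℤ) : ℝ)

variable {m : ℕ} {L : List (List ℤ × ℤ)} {U : List (List ℤ)} {num : ℤ} {den : ℕ}

/-- Inner product of two attached normal vectors: `⟪u, u'⟫ = u·u'`. -/
theorem inner_nvec (u u' : List ℤ) (hu : u.length = m) (hu' : u'.length = m) :
    inner ℝ (nvec m u) (nvec m u') = ((dotL u u' : ℤ) : ℝ) := by
  rw [nvec, nvec, EuclideanSpace.inner_toLp_toLp, dotProduct]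
  simp only [star_trivial]
  have h := sum_getD_mul_getD (Int.castRingHom ℝ) m u u' hu hu'
  simp only [eq_intCast] at h
  rw [← h]
  exact Finset.sum_congr rfl fun i _ => by ring

/-- Inner product of a normal vector with a code point: `⟪u, x/w⟫ = (u·x)/w`. -/
theorem inner_nvec_pt (u : List ℤ) (p : List ℤ × ℤ) (hu : u.length = m) (hp : p.1.length = m) :
    inner ℝ (nvec m u) (pt m p) = ((dotL u p.1 : ℤ) : ℝ) / (p.2 : ℝ) := by
  rw [nvec, pt, EuclideanSpace.inner_toLp_toLp, dotProduct]
  simp only [star_trivial]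
  have h := sum_getD_mul_getD (Int.castRingHom ℝ) m u p.1 hu hp
  simp only [eq_intCast] at h
  calc ∑ i : Fin m, ((p.2 : ℝ))⁻¹ * ((p.1.getD i 0 : ℤ) : ℝ) * ((u.getD i 0 : ℤ) : ℝ)
      = ((p.2 : ℝ))⁻¹ * ∑ i : Fin m, ((u.getD i 0 : ℤ) : ℝ) * ((p.1.getD i 0 : ℤ) : ℝ) := by
        rw [Finset.mul_sum]; exact Finset.sum_congr rfl fun i _ => by ring
    _ = ((dotL u p.1 : ℤ) : ℝ) / (p.2 : ℝ) := by rw [h]; ring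

/-- Unpacking `normalsOK`. -/
theorem of_normalsOK (hN : normalsOK L U m = true) :
    (∀ u ∈ U, u.length = m ∧ 0 < dotL u u) ∧
    (∀ i j : Fin U.length, i ≠ j → dotL (U.get i) (U.get j) = 0) ∧
    (∀ u ∈ U, ∀ p ∈ L, dotL u p.1 = 0) := by
  simp only [normalsOK, Bool.and_eq_true, List.all_eq_true, beq_iff_eq, decide_eq_true_eq,
    List.mem_range, Bool.or_eq_true] at hN
  obtain ⟨⟨h1, h2⟩, h3⟩ := hN
  refine ⟨h1, fun i j hij => ?_, h3⟩
  have h := h2 i.1 i.2 j.1 j.2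
  rcases h with h | h
  · exact absurd (Fin.ext h) hij
  · rwa [List.getD_eq_getElem _ _ i.2, List.getD_eq_getElem _ _ j.2, ← List.get_eq_getElem,
      ← List.get_eq_getElem] at h

/-- The attached normals are linearly independent (nonzero and pairwise orthogonal). -/
theorem linearIndependent_nvec (hN : normalsOK L U m = true) :
    LinearIndependent ℝ fun i : Fin U.length => nvec m (U.get i) := by
  obtain ⟨h1, h2, -⟩ := of_normalsOK hN
  apply linearIndependent_of_ne_zero_of_inner_eq_zero
  · intro i h
    have hu := h1 (U.get i) (List.get_mem U i)
    have h0 : inner ℝ (nvec m (U.get i)) (nvec m (U.get i)) = 0 := by rw [h, inner_zero_left]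
    rw [inner_nvec _ _ hu.1 hu.1] at h0
    have : (0 : ℝ) < ((dotL (U.get i) (U.get i) : ℤ) : ℝ) := by exact_mod_cast hu.2
    linarith
  · intro i j hij
    have hi := h1 (U.get i) (List.get_mem U i)
    have hj := h1 (U.get j) (List.get_mem U j)
    rw [inner_nvec _ _ hi.1 hj.1, h2 i j hij]
    simp

/-- Every code point is orthogonal to every attached normal. -/
theorem inner_nvec_code (hS : sphereOK L m = true) (hN : normalsOK L U m = true) :
    ∀ x ∈ code m L, ∀ i : Fin U.length, inner ℝ (nvec m (U.get i)) x = 0 := by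
  obtain ⟨h1, -, h3⟩ := of_normalsOK hN
  intro x hx i
  obtain ⟨k, _, rfl⟩ := Finset.mem_image.1 hx
  have hp := of_sphereOK hS (List.get_mem L k)
  have hu := h1 (U.get i) (List.get_mem U i)
  rw [inner_nvec_pt _ _ hu.1 hp.1, h3 (U.get i) (List.get_mem U i) (L.get k) (List.get_mem L k)]
  simp

/-- **Transfer packaging.** An integer-point code in `ℝᵐ` passing `sphereOK`, `pairsOK num den` (`0 < den`,
`num < den`) and `normalsOK` for a list `U` of `k` normals with `m = n + k` gives `|L|` unit vectors of `ℝⁿ` with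
pairwise inner products `≤ num/den`. -/
theorem exists_code_transfer {n k : ℕ} (hm : m = n + k) (hS : sphereOK L m = true)
    (hP : pairsOK L num den = true) (hden : 0 < den) (hlt : num < den)
    (hN : normalsOK L U m = true) (hk : U.length = k) :
    ∃ C : Finset (EuclideanSpace ℝ (Fin n)), C.card = L.length ∧
      (∀ x ∈ C, ‖x‖ = 1) ∧ ∀ x ∈ C, ∀ y ∈ C, x ≠ y → inner ℝ x y ≤ (num : ℝ) / den := by
  subst hk
  obtain ⟨C', hc, hno, hi, -⟩ := exists_transfer_orthogonal (m := m) (n := n) (k := U.length) hm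
    (fun i => nvec m (U.get i)) (linearIndependent_nvec hN) (code m L)
    (fun x hx i => inner_nvec_code hS hN x hx i)
  refine ⟨C', by rw [hc, card_eq hS hP hden hlt], fun x' hx' => ?_, fun x' hx' y' hy' hne => ?_⟩
  · obtain ⟨x, hx, he⟩ := hno x' hx'
    rw [he]; exact norm_eq_one hS x hx
  · obtain ⟨x, hx, y, hy, hxy, he⟩ := hi x' hx' y' hy' hne
    rw [he]; exact inner_le hS hP hden x hx y hy hxy

end Summit.Ventures.PackingBounds.Config.IntCode
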